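import Summits.MatrixMultiplication.MatrixMultiplication.Theorems.OutsiderSandwichExchangeRate
import Summits.MatrixMultiplication.MatrixMultiplication.Theorems.OutsiderSandwichTwistSlices
import Summits.MatrixMultiplication.MatrixMultiplication.Theorems.OutsiderSandwichCoherentProfile
import Summits.MatrixMultiplication.MatrixMultiplication.Theorems.OutsiderSandwichSubcoreThreeTwo
import HarnessLib

/-!
# The wiring bridge: `Helped N B` is a wiring identity `Σ R(τ_c(A X) · L Y) = X · Y`

Route `OutsiderSandwich` (decomposition cell `decomp-mm`, lens 4 «minimal counterexample /
extremal reduction», gen 28, kernel 5), support for the aside leaf `BlockOneIsMM`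
(stmt-MatrixMultiplication-27147, `θ⋆ = 0`); cut of record untouched; theorem-only.

The leaf's matrix is `Helped N B : ⟨B⟩ ⊠ C₁^{⊠N} ⊵ ⟨2,2,2⟩^{⊠N}` (`OutsiderSandwichExchangeRate`);
the structural kernels of g24–g28 (`…CoherentSharing`, `…CoherentProfile`, `…ZeroSlack`,
`…SubcoreThreeTwo`) speak about the WIRING NORMAL FORM `Σ_{(i,c)} R_{i,c}(τ_c(A_i X) · L_{i,c} Y)
= X · Y`.  Here every restriction IS shown to be such a wiring (critic g27 r1), by contracting the
restriction identity against the slice formulas of `OutsiderSandwichTwistSlices`: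
`xLeg α i` / `yLeg β i c` / `zLeg γ i c` are the legs of copy `i`, block `c`, read off the
restriction matrices (`A_i X` pulls `Xᵀ` back along `α` into the matrix leg; `L_{i,c} Y` pulls
`Y` back along `β` into the inputs of half-pattern `c`; `R_{i,c}` pushes the outputs of
half-pattern `c + 1` out along `γ`, transposed); `wiring_of_restriction` / `wiring_of_helped` —
`Σ_{(i,c) ∈ Fin B × (ℤ/2)^N} R_{i,c}(τ_c(A_i X) · L_{i,c} Y) = X · Y`; `wiring_on_support` — the
sum may run over any `T ⊇` the blocks with nonzero `y`- and `z`-legs.  Consequences on the leaf's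
own objects: `not_helped_one` (`C₁^{⊠N} ⋭ ⟨2,2,2⟩^{⊠N}` for `N ≥ 1`, zero-slack rigidity),
`helped_coherent_profile` (a COHERENT restriction has `B ≥ max((4/3)^j, 2^{N-j})` for some `j`),
`helped_three_two_incoherent` (a restriction witnessing `Helped 3 2` has an incoherent copy).

References: V. Strassen, *The asymptotic spectrum of tensors*, J. reine angew. Math. 384 (1988),
Thm. 3.8 [Strassen1988]; M. Bläser, *Fast Matrix Multiplication*, ToC Graduate Surveys 5 (2013),
§4–5 (restrictions in coordinates) [Blaser2013].
-/

noncomputable section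

open scoped BigOperators Matrix

set_option linter.dupNamespace false
set_option autoImplicit false

namespace Summit.MatrixMultiplication.MatrixMultiplication.Theorems.OutsiderSandwichWiringBridge

open Literature.Computability.AlgebraicComplexity
  Summit.MatrixMultiplication.MatrixMultiplication.Theorems.OutsiderSandwichCoupling
  Summit.MatrixMultiplication.MatrixMultiplication.Theorems.OutsiderSandwichBlockNormalForm
  Summit.MatrixMultiplication.MatrixMultiplication.Theorems.OutsiderSandwichTwistGluing
  Summit.MatrixMultiplication.MatrixMultiplication.Theorems.OutsiderSandwichTwistSlices
open Summit.MatrixMultiplication.MatrixMultiplication.Theorems.OutsiderSandwichExchangeRate (Helped)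

variable {N B : ℕ}

/-! ## 1. Index bookkeeping -/

/-- Source indices of `C₁^{⊠N}`: strings over `Fin 4`. -/
abbrev Src (N : ℕ) : Type := Fin N → Fin 4
/-- Target indices of `⟨2,2,2⟩^{⊠N}`: strings of bit pairs. -/
abbrev Tgt (N : ℕ) : Type := Fin N → Fin 2 × Fin 2
/-- Encode (half-pattern, positions) as a source string. -/
def encH (p : Idx N × Idx N) : Src N := fun n => decode.symm (p.1 n, p.2 n)
/-- Encode a pair of bit strings as a target string. -/
def encP (p : Idx N × Idx N) : Tgt N := fun n => (p.1 n, p.2 n)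

/-- `half` of an encoded pair. -/
theorem half_symm (a b : Fin 2) : half (decode.symm (a, b)) = a := by
  have h := decode.apply_symm_apply (a, b); rw [decode_apply] at h; exact congrArg Prod.fst h

/-- `pos` of an encoded pair. -/
theorem pos_symm (a b : Fin 2) : pos (decode.symm (a, b)) = b := by
  have h := decode.apply_symm_apply (a, b); rw [decode_apply] at h; exact congrArg Prod.snd h

/-- `Src N ≃ (ℤ/2)^N × (ℤ/2)^N`, `s ↦ (half ∘ s, pos ∘ s)`, inverse `encH`. -/
def srcEquiv (N : ℕ) : Src N ≃ Idx N × Idx N where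
  toFun s := (fun n => half (s n), fun n => pos (s n))
  invFun := encH
  left_inv s := funext fun n => by
    show decode.symm (half (s n), pos (s n)) = s n
    rw [← decode_apply, Equiv.symm_apply_apply]
  right_inv p := by
    obtain ⟨c, v⟩ := p
    simp only [encH, half_symm, pos_symm]

/-- `Tgt N ≃ (ℤ/2)^N × (ℤ/2)^N`, `t ↦ (fst ∘ t, snd ∘ t)`, inverse `encP`. -/
def tgtEquiv (N : ℕ) : Tgt N ≃ Idx N × Idx N where
  toFun t := (fun n => (t n).1, fun n => (t n).2)
  invFun := encP
  left_inv _ := funext fun _ => rfl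
  right_inv _ := rfl

/-- The matrix `(r, s) ↦ F(enc(r, s))` read off a source vector `F`. -/
def srcMat (F : Src N → ℂ) : Matrix (Idx N) (Idx N) ℂ := Matrix.of fun r s => F (encH (r, s))

/-! ## 2. Sum manipulation -/
section Sums
variable {K : Type*} [CommSemiring K] {I J : Type*} [Fintype I] [Fintype J]

/-- `Σ_j y_j Σ_i u_i v_{ij} = Σ_i u_i Σ_j y_j v_{ij}`. -/
theorem sum_mul_sum_comm (y : J → K) (u : I → K) (v : I → J → K) :
    ∑ j, y j * ∑ i, u i * v i j = ∑ i, u i * ∑ j, y j * v i j := by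
  simp only [Finset.mul_sum]
  rw [Finset.sum_comm]
  exact Finset.sum_congr rfl fun i _ => Finset.sum_congr rfl fun j _ => by ring

/-- `Σ_j y_j Σ_i β_{ji} C_i = Σ_i (Σ_j β_{ji} y_j) C_i`. -/
theorem sum_mul_sum_contract (y : J → K) (β : J → I → K) (C : I → K) :
    ∑ j, y j * ∑ i, β j i * C i = ∑ i, (∑ j, β j i * y j) * C i := by
  simp only [Finset.mul_sum, Finset.sum_mul]
  rw [Finset.sum_comm]
  exact Finset.sum_congr rfl fun i _ => Finset.sum_congr rfl fun j _ => by ring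
end Sums

/-! ## 3. The three legs -/

/-- The `x`-leg of copy `i`: `(A_i X)_{r,s} = Σ_{a'} α(a', (i, enc(r,s))) · X_{a'₂, a'₁}`. -/
def xLeg (α : Tgt N → Fin B × Src N → ℂ) (i : Fin B) :
    Matrix (Idx N) (Idx N) ℂ →ₗ[ℂ] Matrix (Idx N) (Idx N) ℂ where
  toFun X := fun r s => ∑ a' : Tgt N, α a' (i, encH (r, s)) * X (fun n => (a' n).2) (fun n => (a' n).1)
  map_add' X X' := by
    ext r s
    simp only [Matrix.add_apply, mul_add, Finset.sum_add_distrib]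
  map_smul' a X := by
    ext r s
    simp only [Matrix.smul_apply, smul_eq_mul, RingHom.id_apply, Finset.mul_sum, mul_left_comm]

/-- The `y`-leg of block `(i, c)`: `(L_{i,c} Y)_v = Σ_{b'} β(b', (i, enc(c,v))) · Y_{b'₁, b'₂}`. -/
def yLeg (β : Tgt N → Fin B × Src N → ℂ) (i : Fin B) (c : Idx N) :
    Matrix (Idx N) (Idx N) ℂ →ₗ[ℂ] (Idx N → ℂ) where
  toFun Y := fun v => ∑ b' : Tgt N, β b' (i, encH (c, v)) * Y (fun n => (b' n).1) (fun n => (b' n).2)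
  map_add' Y Y' := by
    ext v
    simp only [Pi.add_apply, Matrix.add_apply, mul_add, Finset.sum_add_distrib]
  map_smul' a Y := by
    ext v
    simp only [Pi.smul_apply, Matrix.smul_apply, smul_eq_mul, RingHom.id_apply, Finset.mul_sum,
      mul_left_comm]

/-- The `z`-leg of block `(i, c)`: `(R_{i,c} w)_{μ,ν} = Σ_o γ(enc(ν,μ), (i, enc(c+1,o))) · w_o`. -/
def zLeg (γ : Tgt N → Fin B × Src N → ℂ) (i : Fin B) (c : Idx N) :
    (Idx N → ℂ) →ₗ[ℂ] Matrix (Idx N) (Idx N) ℂ where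
  toFun w := fun μ ν => ∑ o : Idx N, γ (encP (ν, μ)) (i, encH (c + 1, o)) * w o
  map_add' w w' := by
    ext μ ν
    simp only [Matrix.add_apply, Pi.add_apply, mul_add, Finset.sum_add_distrib]
  map_smul' a w := by
    ext μ ν
    simp only [Matrix.smul_apply, Pi.smul_apply, smul_eq_mul, RingHom.id_apply, Finset.mul_sum,
      mul_left_comm]

/-! ## 4. Contracting the target: `⟨2,2,2⟩^{⊠N}` against `Xᵀ ⊗ Y` gives `X · Y` -/

/-- `Σ_{a',b'} X_{a'₂ a'₁} Y_{b'₁ b'₂} ⟨2,2,2⟩^{⊠N}(a', b', enc(ν, μ)) = (X · Y)_{μ ν}`. -/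
theorem contract_matMul (X Y : Matrix (Idx N) (Idx N) ℂ) (μ ν : Idx N) :
    ∑ a' : Tgt N, ∑ b' : Tgt N, X (fun n => (a' n).2) (fun n => (a' n).1) *
        Y (fun n => (b' n).1) (fun n => (b' n).2) *
        kroneckerPow (matMulTensor ℂ 2 2 2) N a' b' (encP (ν, μ)) = (X * Y) μ ν := by
  have h1 : ∀ a' : Tgt N, ∑ b' : Tgt N, X (fun n => (a' n).2) (fun n => (a' n).1) *
      Y (fun n => (b' n).1) (fun n => (b' n).2) *
      kroneckerPow (matMulTensor ℂ 2 2 2) N a' b' (encP (ν, μ)) =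
      X (fun n => (a' n).2) (fun n => (a' n).1) *
        if ∀ n, (a' n).2 = μ n then Y (fun n => (a' n).1) ν else 0 := by
    intro a'
    simp_rw [mul_assoc]
    rw [← Finset.mul_sum, slice_pow_matMul, ptrans_zero]
    rfl
  simp_rw [h1]
  rw [Fintype.sum_equiv (tgtEquiv N)
    (fun a' : Tgt N => X (fun n => (a' n).2) (fun n => (a' n).1) *
      if ∀ n, (a' n).2 = μ n then Y (fun n => (a' n).1) ν else 0)
    (fun p : Idx N × Idx N => X p.2 p.1 * if ∀ n, p.2 n = μ n then Y p.1 ν else 0) (fun a' => rfl),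
    Fintype.sum_prod_type, Matrix.mul_apply]
  refine Finset.sum_congr rfl fun κ _ => ?_
  rw [Finset.sum_eq_single μ]
  · simp only [implies_true, if_true]
  · intro μ' _ hne
    rw [if_neg (fun h => hne (funext h)), mul_zero]
  · intro h; exact absurd (Finset.mem_univ μ) h

/-! ## 5. Contracting the source: `⟨B⟩ ⊠ C₁^{⊠N}` against the pulled-back legs -/

/-- Stage 1: push the two contractions through the restriction matrices. -/
theorem contract_source_stage1 {S T : Type*} [Fintype S] [Fintype T] (x y : T → ℂ)
    (α β : T → S → ℂ) (γc : S → ℂ) (t : S → S → S → ℂ) :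
    ∑ a', ∑ b', x a' * y b' * ∑ a, ∑ b, ∑ c, α a' a * β b' b * γc c * t a b c =
      ∑ a, (∑ a', α a' a * x a') * ∑ b, (∑ b', β b' b * y b') * ∑ c, γc c * t a b c := by
  have h1 : ∀ a' b', ∑ a, ∑ b, ∑ c, α a' a * β b' b * γc c * t a b c =
      ∑ a, α a' a * ∑ b, β b' b * ∑ c, γc c * t a b c := by
    intro a' b'
    simp only [Finset.mul_sum, mul_assoc]
  simp_rw [h1]
  calc ∑ a', ∑ b', x a' * y b' * ∑ a, α a' a * ∑ b, β b' b * ∑ c, γc c * t a b c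
      = ∑ a', x a' * ∑ b', y b' * ∑ a, α a' a * ∑ b, β b' b * ∑ c, γc c * t a b c := by
        simp only [Finset.mul_sum, mul_assoc]
    _ = ∑ a', x a' * ∑ a, α a' a * ∑ b', y b' * ∑ b, β b' b * ∑ c, γc c * t a b c :=
        Finset.sum_congr rfl fun a' _ => by rw [sum_mul_sum_comm]
    _ = ∑ a', x a' * ∑ a, α a' a * ∑ b, (∑ b', β b' b * y b') * ∑ c, γc c * t a b c :=
        Finset.sum_congr rfl fun a' _ => by
          congr 1
          exact Finset.sum_congr rfl fun a _ => by rw [sum_mul_sum_contract]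
    _ = ∑ a, (∑ a', α a' a * x a') * ∑ b, (∑ b', β b' b * y b') * ∑ c, γc c * t a b c := by
        rw [sum_mul_sum_contract]

/-- Stage 2: the unit tensor `⟨B⟩` restricts the three source legs to a common copy `i`. -/
theorem contract_source_stage2 {S : Type*} [Fintype S] (F G H : Fin B × S → ℂ)
    (P : S → S → S → ℂ) :
    ∑ a : Fin B × S, F a * ∑ b : Fin B × S, G b * ∑ c : Fin B × S, H c *
        (unitTensor ℂ B a.1 b.1 c.1 * P a.2 b.2 c.2) =
      ∑ i : Fin B, ∑ a₂ : S, F (i, a₂) * ∑ b₂ : S, G (i, b₂) * ∑ c₂ : S, H (i, c₂) * P a₂ b₂ c₂ := by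
  simp only [Fintype.sum_prod_type, unitTensor_apply]
  refine Finset.sum_congr rfl fun i _ => Finset.sum_congr rfl fun a₂ _ => ?_
  congr 1
  rw [Finset.sum_eq_single i]
  · refine Finset.sum_congr rfl fun b₂ _ => ?_
    congr 1
    rw [Finset.sum_eq_single i]
    · exact Finset.sum_congr rfl fun c₂ _ => by rw [if_pos ⟨rfl, rfl⟩, one_mul]
    · intro k _ hk
      exact Finset.sum_eq_zero fun c₂ _ => by rw [if_neg (fun h => hk h.2.symm), zero_mul, mul_zero]
    · intro h; exact absurd (Finset.mem_univ i) h
  · intro j _ hj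
    refine Finset.sum_eq_zero fun b₂ _ => ?_
    rw [Finset.sum_eq_zero fun k _ => Finset.sum_eq_zero fun c₂ _ => by
      rw [if_neg (fun h => hj h.1.symm), zero_mul, mul_zero], mul_zero]
  · intro h; exact absurd (Finset.mem_univ i) h

/-- Stage 3: the matrix leg of `C₁^{⊠N}` against a source vector `F` is a partial transpose of
`srcMat F` (the slice formula of `OutsiderSandwichTwistSlices`). -/
theorem contract_source_stage3 (F : Src N → ℂ) (b₂ c₂ : Src N) :
    ∑ a₂ : Src N, F a₂ * kroneckerPow coupling₁ N a₂ b₂ c₂ =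
      if ∀ n, half (c₂ n) = half (b₂ n) + 1 then
        ptrans (fun n => half (b₂ n)) (srcMat F) (fun n => pos (c₂ n)) (fun n => pos (b₂ n))
      else 0 := by
  simp_rw [kroneckerPow_coupling₁_eq]
  rw [Fintype.sum_equiv (Equiv.piCongrRight fun _ : Fin N => decode)
    (fun a₂ : Src N => F a₂ * kroneckerPow (pairTensor 2) N (fun n => decode (a₂ n))
      (fun n => decode (b₂ n)) (fun n => decode (c₂ n)))
    (fun x : Tgt N => srcMat F (fun n => (x n).1) (fun n => (x n).2) *
      kroneckerPow (pairTensor 2) N x (fun n => decode (b₂ n)) (fun n => decode (c₂ n)))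
    (fun a₂ => ?_), slice_pow_pairTensor]
  · rfl
  · congr 1
    show F a₂ = F (encH (fun n => (decode (a₂ n)).1, fun n => (decode (a₂ n)).2))
    congr 1
    funext n
    show a₂ n = decode.symm ((decode (a₂ n)).1, (decode (a₂ n)).2)
    rw [Prod.mk.eta, Equiv.symm_apply_apply]

/-- Stage 4: the blocks of a copy (input half-pattern `c`, output forced to `c + 1`); `τ_c(M) · L`. -/
theorem contract_source_stage4 (G H : Src N → ℂ) (M : Matrix (Idx N) (Idx N) ℂ) :
    ∑ b₂ : Src N, G b₂ * ∑ c₂ : Src N, H c₂ *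
        (if ∀ n, half (c₂ n) = half (b₂ n) + 1 then
          ptrans (fun n => half (b₂ n)) M (fun n => pos (c₂ n)) (fun n => pos (b₂ n)) else 0) =
      ∑ c : Idx N, ∑ o : Idx N, H (encH (c + 1, o)) *
        Matrix.mulVec (ptrans c M) (fun v => G (encH (c, v))) o := by
  rw [← (srcEquiv N).symm.sum_comp, Fintype.sum_prod_type]
  refine Finset.sum_congr rfl fun c _ => ?_
  have hin : ∀ v : Idx N, ∑ c₂ : Src N, H c₂ *
      (if ∀ n, half (c₂ n) = half ((srcEquiv N).symm (c, v) n) + 1 then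
        ptrans (fun n => half ((srcEquiv N).symm (c, v) n)) M (fun n => pos (c₂ n))
          (fun n => pos ((srcEquiv N).symm (c, v) n)) else 0) =
      ∑ o : Idx N, H (encH (c + 1, o)) * ptrans c M o v := by
    intro v
    have hcv : ∀ n, (srcEquiv N).symm (c, v) n = decode.symm (c n, v n) := fun n => rfl
    simp only [hcv, half_symm, pos_symm]
    rw [← (srcEquiv N).symm.sum_comp, Fintype.sum_prod_type, Finset.sum_eq_single (c + 1)]
    · refine Finset.sum_congr rfl fun o _ => ?_
      have hco : ∀ n, (srcEquiv N).symm (c + 1, o) n = decode.symm ((c + 1) n, o n) := fun n => rfl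
      simp only [hco, half_symm, pos_symm]
      rw [if_pos (show ∀ n, (c + 1) n = c n + 1 from fun n => rfl)]
      rfl
    · intro d _ hd
      refine Finset.sum_eq_zero fun o _ => ?_
      have hdo : ∀ n, (srcEquiv N).symm (d, o) n = decode.symm (d n, o n) := fun n => rfl
      simp only [hdo, half_symm, pos_symm]
      rw [if_neg (show ¬ (∀ n, d n = c n + 1) from fun h => hd (funext fun n => h n)), mul_zero]
    · intro h; exact absurd (Finset.mem_univ _) h
  have hG : ∀ v : Idx N, G ((srcEquiv N).symm (c, v)) = G (encH (c, v)) := fun v => rfl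
  simp_rw [hin, hG]
  rw [sum_mul_sum_comm]
  refine Finset.sum_congr rfl fun o _ => ?_
  congr 1
  simp only [Matrix.mulVec, dotProduct]
  exact Finset.sum_congr rfl fun v _ => mul_comm _ _

/-! ## 6. The bridge -/
/-- **Every restriction `⟨B⟩ ⊠ C₁^{⊠N} ⊵ ⟨2,2,2⟩^{⊠N}` is a wiring.**  If `(α, β, γ)` are
restriction matrices, then with the legs of §3:
`Σ_{(i,c)} R_{i,c}(τ_c(A_i X) · L_{i,c} Y) = X · Y` for all `2^N × 2^N` matrices `X, Y`. -/
theorem wiring_of_restriction (α β γ : Tgt N → Fin B × Src N → ℂ)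
    (hres : ∀ a' b' c' : Tgt N, kroneckerPow (matMulTensor ℂ 2 2 2) N a' b' c' =
      ∑ a, ∑ b, ∑ c, α a' a * β b' b * γ c' c *
        kroneckerTensor (unitTensor ℂ B) (kroneckerPow coupling₁ N) a b c)
    (X Y : Matrix (Idx N) (Idx N) ℂ) :
    ∑ b : Fin B × Idx N, zLeg γ b.1 b.2
        (Matrix.mulVec (ptrans b.2 (xLeg α b.1 X)) (yLeg β b.1 b.2 Y)) = X * Y := by
  ext μ ν
  rw [Matrix.sum_apply, ← contract_matMul X Y μ ν]
  simp_rw [hres, kroneckerTensor_apply]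
  rw [contract_source_stage1, contract_source_stage2, Fintype.sum_prod_type]
  refine Finset.sum_congr rfl fun i _ => Eq.symm ?_
  -- copy `i`: reorder so that the matrix leg is innermost, then stages 3 and 4
  calc ∑ a₂ : Src N, (∑ a', α a' (i, a₂) * X (fun n => (a' n).2) (fun n => (a' n).1)) *
        ∑ b₂ : Src N, (∑ b', β b' (i, b₂) * Y (fun n => (b' n).1) (fun n => (b' n).2)) *
          ∑ c₂ : Src N, γ (encP (ν, μ)) (i, c₂) * kroneckerPow coupling₁ N a₂ b₂ c₂
      = ∑ b₂ : Src N, (∑ b', β b' (i, b₂) * Y (fun n => (b' n).1) (fun n => (b' n).2)) *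
          ∑ c₂ : Src N, γ (encP (ν, μ)) (i, c₂) *
            ∑ a₂ : Src N, (∑ a', α a' (i, a₂) * X (fun n => (a' n).2) (fun n => (a' n).1)) *
              kroneckerPow coupling₁ N a₂ b₂ c₂ := by
        rw [← sum_mul_sum_comm]
        refine Finset.sum_congr rfl fun b₂ _ => ?_
        congr 1
        rw [← sum_mul_sum_comm]
    _ = ∑ b₂ : Src N, (∑ b', β b' (i, b₂) * Y (fun n => (b' n).1) (fun n => (b' n).2)) *
          ∑ c₂ : Src N, γ (encP (ν, μ)) (i, c₂) *
            (if ∀ n, half (c₂ n) = half (b₂ n) + 1 then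
              ptrans (fun n => half (b₂ n)) (xLeg α i X) (fun n => pos (c₂ n))
                (fun n => pos (b₂ n)) else 0) := by
        simp_rw [contract_source_stage3]
        rfl
    _ = ∑ c : Idx N, zLeg γ i c
          (Matrix.mulVec (ptrans c (xLeg α i X)) (yLeg β i c Y)) μ ν := by
        rw [contract_source_stage4]
        rfl

/-- **`Helped N B` is a wiring** (the hypothesis shape of `…CoherentSharing` / `…ZeroSlack`). -/
theorem wiring_of_helped (h : Helped N B) :
    ∃ (A : Fin B → Matrix (Idx N) (Idx N) ℂ →ₗ[ℂ] Matrix (Idx N) (Idx N) ℂ)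
      (L : Fin B → Idx N → (Matrix (Idx N) (Idx N) ℂ →ₗ[ℂ] (Idx N → ℂ)))
      (R : Fin B → Idx N → ((Idx N → ℂ) →ₗ[ℂ] Matrix (Idx N) (Idx N) ℂ)),
      ∀ X Y : Matrix (Idx N) (Idx N) ℂ,
        ∑ b ∈ (Finset.univ : Finset (Fin B × Idx N)),
          R b.1 b.2 (Matrix.mulVec (ptrans b.2 (A b.1 X)) (L b.1 b.2 Y)) = X * Y := by
  obtain ⟨α, β, γ, hres⟩ := h
  exact ⟨xLeg α, yLeg β, zLeg γ, wiring_of_restriction α β γ hres⟩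

/-- The wiring sum may run over any `T` containing the blocks with nonzero `y`- and `z`-legs. -/
theorem wiring_on_support {K : Type*} [Field K] {ι : Type*} [Fintype ι]
    (A : ι → Matrix (Idx N) (Idx N) K →ₗ[K] Matrix (Idx N) (Idx N) K)
    (L : ι → Idx N → (Matrix (Idx N) (Idx N) K →ₗ[K] (Idx N → K)))
    (R : ι → Idx N → ((Idx N → K) →ₗ[K] Matrix (Idx N) (Idx N) K))
    (ident : ∀ X Y : Matrix (Idx N) (Idx N) K,
      ∑ b ∈ (Finset.univ : Finset (ι × Idx N)),
        R b.1 b.2 (Matrix.mulVec (ptrans b.2 (A b.1 X)) (L b.1 b.2 Y)) = X * Y)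
    (T : Finset (ι × Idx N)) (hT : ∀ b ∉ T, L b.1 b.2 = 0 ∨ R b.1 b.2 = 0)
    (X Y : Matrix (Idx N) (Idx N) K) :
    ∑ b ∈ T, R b.1 b.2 (Matrix.mulVec (ptrans b.2 (A b.1 X)) (L b.1 b.2 Y)) = X * Y := by
  rw [← ident X Y]
  refine Finset.sum_subset (Finset.subset_univ T) fun b _ hb => ?_
  rcases hT b hb with h | h
  · rw [h, LinearMap.zero_apply, Matrix.mulVec_zero, map_zero]
  · rw [h, LinearMap.zero_apply]

/-! ## 7. Consequences on the leaf's objects -/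
/-- **One copy never helps**: `¬ Helped N 1` for `N ≥ 1`, i.e. `C₁^{⊠N} ⋭ ⟨2,2,2⟩^{⊠N}`
(zero-slack rigidity: here `|T| = 2^N`, so `2^N ≤ B = 1`). -/
theorem not_helped_one (hN : 1 ≤ N) : ¬ Helped N 1 := by
  classical
  intro h
  obtain ⟨A, L, R, ident⟩ := wiring_of_helped h
  have hT : (Finset.univ : Finset (Fin 1 × Idx N)).card ≤ 2 ^ N := by
    rw [Finset.card_univ, Fintype.card_prod, Fintype.card_fin, one_mul,
      OutsiderSandwichTwistCapacity.card_Idx]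
  have h2 := OutsiderSandwichZeroSlack.two_pow_le_card_of_noSlack A Finset.univ L R ident hT
  rw [Fintype.card_fin] at h2
  have : 2 ^ 1 ≤ 2 ^ N := Nat.pow_le_pow_right (by norm_num) hN
  omega

/-- **Coherent restrictions have a level**: if `(α, β, γ)` witness `Helped N B` and every copy is
coherent on `T ⊇` used blocks (`τ_{c+c'} ∘ A_i ∈ ℂ · A_i`), then `4^N ≤ B · 3^j 4^{N-j}` and
`2^{N-j} ≤ B` for some `j ≤ N` (`OutsiderSandwichCoherentProfile`): `B ≥ 2^{0.2933 N}`. -/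
theorem helped_coherent_profile (α β γ : Tgt N → Fin B × Src N → ℂ)
    (hres : ∀ a' b' c' : Tgt N, kroneckerPow (matMulTensor ℂ 2 2 2) N a' b' c' =
      ∑ a, ∑ b, ∑ c, α a' a * β b' b * γ c' c *
        kroneckerTensor (unitTensor ℂ B) (kroneckerPow coupling₁ N) a b c)
    (T : Finset (Fin B × Idx N)) (hT : ∀ b ∉ T, yLeg β b.1 b.2 = 0 ∨ zLeg γ b.1 b.2 = 0)
    (hRel : ∀ i c c', (i, c) ∈ T → (i, c') ∈ T →
      ∃ ε : ℂ, ∀ X, ptrans (c + c') (xLeg α i X) = ε • xLeg α i X) :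
    ∃ j ≤ N, 4 ^ N ≤ B * (3 ^ j * 4 ^ (N - j)) ∧ 2 ^ (N - j) ≤ B := by
  classical
  have h := OutsiderSandwichCoherentProfile.exists_profile_of_coherent (xLeg α) T (yLeg β)
    (zLeg γ) (wiring_on_support (xLeg α) (yLeg β) (zLeg γ) (wiring_of_restriction α β γ hres) T hT)
    hRel
  rwa [Fintype.card_fin] at h

/-- **A `(3, 2)` restriction has an incoherent copy**: some copy `i` has blocks `c ≠ c'` in `T`
(`T ⊇` used blocks) with `τ_{c+c'} ∘ A_i ∉ ℂ · A_i` (`OutsiderSandwichSubcoreThreeTwo`). -/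
theorem helped_three_two_incoherent (α β γ : Tgt 3 → Fin 2 × Src 3 → ℂ)
    (hres : ∀ a' b' c' : Tgt 3, kroneckerPow (matMulTensor ℂ 2 2 2) 3 a' b' c' =
      ∑ a, ∑ b, ∑ c, α a' a * β b' b * γ c' c *
        kroneckerTensor (unitTensor ℂ 2) (kroneckerPow coupling₁ 3) a b c)
    (T : Finset (Fin 2 × Idx 3)) (hT : ∀ b ∉ T, yLeg β b.1 b.2 = 0 ∨ zLeg γ b.1 b.2 = 0) :
    ∃ i c c', (i, c) ∈ T ∧ (i, c') ∈ T ∧ c ≠ c' ∧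
      ∀ ε : ℂ, ∃ X, ptrans (c + c') (xLeg α i X) ≠ ε • xLeg α i X := by
  classical
  exact OutsiderSandwichSubcoreThreeTwo.exists_incoherent_copy_three_two (by rw [Fintype.card_fin])
    (xLeg α) T (yLeg β) (zLeg γ)
    (wiring_on_support (xLeg α) (yLeg β) (zLeg γ) (wiring_of_restriction α β γ hres) T hT)

end Summit.MatrixMultiplication.MatrixMultiplication.Theorems.OutsiderSandwichWiringBridge
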